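import Literature.NumberTheory.Sieve.BombieriAsymptoticSieveLemma12T
import Literature.NumberTheory.Sieve.LargestPrimeFactorCubicMertens
import Literature.NumberTheory.LFunctions.ZetaLogDerivRealBound

/-!
# SoloInformedLogMomentConvergence — log-power decay of `∑_{n ≤ N} c(n)` gives convergence of `∑ c(n) logʲ n`

Solo unit `solo-Parity-informed` (ideation tier, informed mode), session 17; `PLAN.md` §25.3 (α2), CLAIMS C81.

**Abel summation lemma.**  If the partial sums `S(N) = ∑_{n ≤ N} c(n)` satisfy
`|S(N)| ≤ C/(1 + log N)^{j+2}` for all `N ≥ 1`, then `∑_{n ≤ N} c(n) logʲ n` converges as `N → ∞`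
(`exists_tendsto_sum_mul_log_pow_of_decay`).  Proof: `∑_{n ≤ N} c(n) logʲ n = S(N) logʲ N +
∑_{n < N} S(n)(logʲ n - logʲ(n+1))`, the first term is `O(1/(1 + log N)²)` and the series converges
absolutely by comparison with `∑ 1/(n (1 + log n)²) ≤ ∑ (1/(1 + log n) - 1/(1 + log(n+1)))`
(elementary inequalities reused from `BombieriSieve`, `LargestPrimeFactorCubic`, `FordL31`).
Applied with `c(n) = μ(n) ρ_F(n)/n` and `j = k` it gives the existence of the `k`-th log-moment limit
`lim ∑_{e ≤ y} μ(e) ρ_F(e) logᵏ e / e` for every Bateman–Horn system, the value being identified in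
`SoloInformedLogMomentAbelian`.
-/

namespace Summit.Parity.BatemanHorn.Theorems

open Finset Filter Real
open scoped Topology

/-! ### Elementary inequalities -/

/-- Abel summation without normalisation: `∑_{n ≤ N} c(n) ψ(n) = S(N) ψ(N) + ∑_{1 ≤ n < N} S(n)(ψ(n) - ψ(n+1))`. -/
theorem sum_mul_kernel_eq (c ψ : ℕ → ℝ) {N : ℕ} (hN : 1 ≤ N) :
    ∑ n ∈ Icc 1 N, c n * ψ n
      = (∑ n ∈ Icc 1 N, c n) * ψ N + ∑ n ∈ Ico 1 N, (∑ m ∈ Icc 1 n, c m) * (ψ n - ψ (n + 1)) := by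
  induction N, hN using Nat.le_induction with
  | base => simp
  | succ N hN ih =>
    rw [sum_Icc_succ_top (by omega), sum_Icc_succ_top (by omega), sum_Ico_succ_top hN, ih]
    ring

/-- `log(n+1) ≤ 1 + log n` for `n ≥ 1`. -/
theorem log_succ_le_one_add_log {n : ℕ} (hn : 1 ≤ n) : Real.log ((n : ℝ) + 1) ≤ 1 + Real.log n := by
  have h := Literature.NumberTheory.LFunctions.FordL31.log_succ_sub_log_le hn
  have hn1 : (1 : ℝ) ≤ n := by exact_mod_cast hn
  have : (1 : ℝ) / n ≤ 1 := (div_le_one (by positivity)).mpr hn1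
  linarith

/-- `∑_{n ≥ 2} 1/(n (1 + log n)²) < ∞` (telescoping against `1/(1 + log n)`), indexed from `n = 2`. -/
theorem summable_inv_mul_one_add_log_sq_two :
    Summable fun i : ℕ => 1 / (((i : ℝ) + 2) * (1 + Real.log ((i : ℝ) + 2)) ^ 2) := by
  set g : ℕ → ℝ := fun n => 1 / (1 + Real.log n) with hg
  have hlog1 : ∀ n : ℕ, 1 ≤ n → 0 ≤ Real.log (n : ℝ) := fun n _ => Real.log_natCast_nonneg n
  have hterm : ∀ i : ℕ, 1 / (((i : ℝ) + 2) * (1 + Real.log ((i : ℝ) + 2)) ^ 2) ≤ g (i + 1) - g (i + 2) := by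
    intro i
    have hi1 : 1 ≤ i + 1 := by omega
    have hl1 : 0 ≤ Real.log ((i : ℝ) + 1) := by
      have := hlog1 (i + 1) hi1; push_cast at this; exact this
    have hl2 : Real.log ((i : ℝ) + 1) ≤ Real.log ((i : ℝ) + 2) :=
      Real.log_le_log (by positivity) (by linarith)
    have hdiff : 1 / ((i : ℝ) + 2) ≤ Real.log ((i : ℝ) + 2) - Real.log ((i : ℝ) + 1) := by
      have := Literature.NumberTheory.Sieve.LargestPrimeFactorCubic.inv_succ_le_log_succ_sub_log hi1
      push_cast at this
      rw [show ((i : ℝ) + 1 + 1) = (i : ℝ) + 2 by ring] at this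
      exact this
    have hne1 : 1 + Real.log ((i : ℝ) + 1) ≠ 0 := by linarith
    have hne2 : 1 + Real.log ((i : ℝ) + 2) ≠ 0 := by linarith
    have hgi : g (i + 1) - g (i + 2) = (Real.log ((i : ℝ) + 2) - Real.log ((i : ℝ) + 1))
        / ((1 + Real.log ((i : ℝ) + 1)) * (1 + Real.log ((i : ℝ) + 2))) := by
      simp only [hg]; push_cast
      rw [div_sub_div _ _ hne1 hne2]
      congr 1; ring
    have hm : (0 : ℝ) < (i : ℝ) + 2 := by positivity
    have hdm : 1 ≤ (Real.log ((i : ℝ) + 2) - Real.log ((i : ℝ) + 1)) * ((i : ℝ) + 2) := by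
      rwa [div_le_iff₀ hm] at hdiff
    rw [hgi, div_le_div_iff₀ (by positivity) (mul_pos (by linarith) (by linarith))]
    calc 1 * ((1 + Real.log ((i : ℝ) + 1)) * (1 + Real.log ((i : ℝ) + 2)))
        ≤ 1 * ((1 + Real.log ((i : ℝ) + 2)) * (1 + Real.log ((i : ℝ) + 2))) := by
          rw [one_mul, one_mul]
          exact mul_le_mul_of_nonneg_right (by linarith) (by linarith)
      _ ≤ ((Real.log ((i : ℝ) + 2) - Real.log ((i : ℝ) + 1)) * ((i : ℝ) + 2))
            * ((1 + Real.log ((i : ℝ) + 2)) * (1 + Real.log ((i : ℝ) + 2))) :=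
          mul_le_mul_of_nonneg_right hdm (mul_nonneg (by linarith) (by linarith))
      _ = (Real.log ((i : ℝ) + 2) - Real.log ((i : ℝ) + 1)) * (((i : ℝ) + 2) * (1 + Real.log ((i : ℝ) + 2)) ^ 2) := by
          ring
  refine summable_of_sum_range_le (c := g 1) (fun i => by positivity) fun m => ?_
  calc ∑ i ∈ range m, 1 / (((i : ℝ) + 2) * (1 + Real.log ((i : ℝ) + 2)) ^ 2)
      ≤ ∑ i ∈ range m, (g (i + 1) - g (i + 2)) := sum_le_sum fun i _ => hterm i
    _ = g 1 - g (m + 1) := by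
        rw [Finset.sum_range_sub' (fun i => g (i + 1)) m]
    _ ≤ g 1 := by
        have : 0 ≤ g (m + 1) := by
          simp only [hg]
          have := hlog1 (m + 1) (by omega)
          positivity
        linarith

/-- `∑_{n ≥ 1} 1/(n (1 + log n)²) < ∞`, indexed from `n = 1`. -/
theorem summable_inv_mul_one_add_log_sq :
    Summable fun i : ℕ => 1 / (((i : ℝ) + 1) * (1 + Real.log ((i : ℝ) + 1)) ^ 2) := by
  rw [← summable_nat_add_iff 1]
  refine summable_inv_mul_one_add_log_sq_two.congr fun i => ?_
  push_cast
  ring_nf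

/-! ### Convergence of the log-moments -/

/-- **Log-power decay of the partial sums gives convergence of the `j`-th log-moment.** -/
theorem exists_tendsto_sum_mul_log_pow_of_decay {c : ℕ → ℝ} {j : ℕ} {C : ℝ}
    (hS : ∀ N : ℕ, 1 ≤ N → |∑ n ∈ Icc 1 N, c n| ≤ C / (1 + Real.log N) ^ (j + 2)) :
    ∃ A : ℝ, Tendsto (fun N : ℕ => ∑ n ∈ Icc 1 N, c n * Real.log n ^ j) atTop (𝓝 A) := by
  set S : ℕ → ℝ := fun N => ∑ n ∈ Icc 1 N, c n with hSdef
  have hC0 : 0 ≤ C := by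
    have h := hS 1 le_rfl
    simp only [Nat.cast_one, Real.log_one, add_zero, one_pow, div_one] at h
    exact (abs_nonneg _).trans h
  have hlog0 : ∀ n : ℕ, 0 ≤ Real.log (n : ℝ) := fun n => Real.log_natCast_nonneg n
  -- the series `∑ S(n)(logʲ n - logʲ(n+1))` converges absolutely
  set F : ℕ → ℝ := fun n => S n * (Real.log n ^ j - Real.log ((n : ℝ) + 1) ^ j) with hF
  have hFle : ∀ i : ℕ, ‖F (i + 1)‖ ≤ C * j * (1 / (((i : ℝ) + 1) * (1 + Real.log ((i : ℝ) + 1)) ^ 2)) := by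
    intro i
    have hi1 : 1 ≤ i + 1 := by omega
    set L : ℝ := Real.log ((i : ℝ) + 1) with hL
    set L' : ℝ := Real.log ((i : ℝ) + 1 + 1) with hL'
    have hL0 : 0 ≤ L := by have := hlog0 (i + 1); push_cast at this; exact this
    have hLL' : L ≤ L' := Real.log_le_log (by positivity) (by linarith)
    have hL'1 : L' ≤ 1 + L := by
      have := log_succ_le_one_add_log hi1; push_cast at this; exact this
    have hdiff : L' - L ≤ 1 / ((i : ℝ) + 1) := by
      have := Literature.NumberTheory.LFunctions.FordL31.log_succ_sub_log_le hi1
      push_cast at this; exact this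
    have hSi : |S (i + 1)| ≤ C / (1 + L) ^ (j + 2) := by
      have := hS (i + 1) hi1; push_cast at this; exact this
    rw [Real.norm_eq_abs, hF]
    simp only
    push_cast
    rw [abs_mul, show |L ^ j - L' ^ j| = L' ^ j - L ^ j by
      rw [abs_sub_comm]; exact abs_of_nonneg (sub_nonneg.mpr (pow_le_pow_left₀ hL0 hLL' j))]
    have hpow : L' ^ j - L ^ j ≤ j * (1 + L) ^ (j - 1) * (1 / ((i : ℝ) + 1)) := by
      refine (Literature.NumberTheory.Sieve.BombieriSieve.pow_sub_pow_le_mul hL0 hLL' j).trans ?_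
      exact mul_le_mul (mul_le_mul_of_nonneg_left (pow_le_pow_left₀ (hL0.trans hLL') hL'1 _)
        (Nat.cast_nonneg j)) hdiff (by linarith) (by positivity)
    have h1L : 1 ≤ 1 + L := by linarith
    calc |S (i + 1)| * (L' ^ j - L ^ j)
        ≤ C / (1 + L) ^ (j + 2) * (j * (1 + L) ^ (j - 1) * (1 / ((i : ℝ) + 1))) :=
          mul_le_mul hSi hpow (sub_nonneg.mpr (pow_le_pow_left₀ hL0 hLL' j)) (by positivity)
      _ = C * j * ((1 + L) ^ (j - 1) / (1 + L) ^ (j + 2)) * (1 / ((i : ℝ) + 1)) := by ring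
      _ ≤ C * j * (1 / (1 + L) ^ 2) * (1 / ((i : ℝ) + 1)) := by
          refine mul_le_mul_of_nonneg_right (mul_le_mul_of_nonneg_left ?_ (by positivity))
            (by positivity)
          rw [div_le_div_iff₀ (by positivity) (by positivity), one_mul, ← pow_add]
          exact pow_le_pow_right₀ h1L (by omega)
      _ = C * j * (1 / (((i : ℝ) + 1) * (1 + L) ^ 2)) := by
          rw [mul_assoc (C * j), div_mul_div_comm, one_mul, mul_comm ((1 + L) ^ 2)]
  have hsumF : Summable fun i : ℕ => F (i + 1) :=
    Summable.of_norm_bounded (summable_inv_mul_one_add_log_sq.mul_left (C * j)) hFle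
  obtain ⟨Lsum, hLsum⟩ := hsumF
  -- the boundary term tends to `0`
  have hbd : Tendsto (fun N : ℕ => S N * Real.log N ^ j) atTop (𝓝 0) := by
    have hmaj : Tendsto (fun N : ℕ => C / (1 + Real.log N)) atTop (𝓝 0) := by
      have h1 : Tendsto (fun N : ℕ => 1 + Real.log (N : ℝ)) atTop atTop :=
        tendsto_atTop_add_const_left _ 1 (Real.tendsto_log_atTop.comp tendsto_natCast_atTop_atTop)
      have := (tendsto_inv_atTop_zero.comp h1).const_mul C
      rw [mul_zero] at this
      refine this.congr fun N => ?_
      simp [div_eq_mul_inv]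
    refine squeeze_zero_norm' ?_ hmaj
    filter_upwards [eventually_ge_atTop 1] with N hN
    have hl := hlog0 N
    have h1l : 1 ≤ 1 + Real.log (N : ℝ) := by linarith
    rw [Real.norm_eq_abs, abs_mul, abs_pow, abs_of_nonneg hl]
    calc |S N| * Real.log N ^ j ≤ C / (1 + Real.log N) ^ (j + 2) * (1 + Real.log N) ^ j :=
          mul_le_mul (hS N hN) (pow_le_pow_left₀ hl (by linarith) j) (by positivity) (by positivity)
      _ = C / (1 + Real.log N) * (1 / (1 + Real.log N)) := by
          rw [pow_add]; field_simp
      _ ≤ C / (1 + Real.log N) * 1 := by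
          refine mul_le_mul_of_nonneg_left ((div_le_one (by positivity)).mpr h1l) (by positivity)
      _ = C / (1 + Real.log N) := mul_one _
  -- the series part converges
  have hser : Tendsto (fun N : ℕ => ∑ n ∈ Ico 1 N, F n) atTop (𝓝 Lsum) := by
    have h := hLsum.tendsto_sum_nat.comp (tendsto_sub_atTop_nat 1)
    refine h.congr fun N => ?_
    simp only [Function.comp_def]
    rw [sum_Ico_eq_sum_range]
    exact sum_congr rfl fun i _ => by rw [add_comm]
  refine ⟨0 + Lsum, ?_⟩
  have hsum := hbd.add hser
  refine hsum.congr' ?_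
  filter_upwards [eventually_ge_atTop 1] with N hN
  rw [sum_mul_kernel_eq c (fun n => Real.log n ^ j) hN]
  simp only [hF, hSdef]
  push_cast
  rfl

end Summit.Parity.BatemanHorn.Theorems
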